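import Summits.RiemannHypothesis.RiemannHypothesis.Theses.ShiftedResolvent
import Literature.NumberTheory.LFunctions.WeilResolventVectorExists

/-! Scratch: the restated items (menu R1 of MISSTATED.md) and the route's `closes` proof script VERBATIM. -/

set_option linter.style.longLine false

namespace RestateR1

open scoped BigOperators Topology Manifold Classical MeasureTheory ProbabilityTheory Matrix InnerProductSpace ComplexConjugate ContinuousMap
open Filter Set Function TopologicalSpace MeasureTheory

def ResolventConvergence : Prop :=
  ∃ (a : ℕ → ℝ) (lam : ℕ → ℝ) (v : ℕ → ℝ → ℂ) (c : ℕ → ℂ) (F : ℂ → ℂ), Tendsto a atTop atTop ∧ (∀ k, 0 < a k ∧ lam k < Literature.NumberTheory.LFunctions.weilGroundEnergy (a k) ∧ c k ≠ 0 ∧ Literature.NumberTheory.LFunctions.IsWeilResolventVector (a k) (lam k) (v k)) ∧ TendstoLocallyUniformlyOn (fun k s => c k * Literature.NumberTheory.LFunctions.weilMellin (v k) s) F atTop {s : ℂ | 1 / 2 < s.re ∧ s.re < 1} ∧ (∃ s : ℂ, (1 / 2 < s.re ∧ s.re < 1) ∧ F s ≠ 0) ∧ (∀ s : ℂ, 1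 / 2 < s.re → s.re < 1 → Literature.NumberTheory.LFunctions.riemannXi s = 0 → F s = 0)

def ResolventRealZeros : Prop :=
  ∀ a : ℝ, 0 < a → ∀ lam : ℝ, lam < Literature.NumberTheory.LFunctions.weilGroundEnergy a → ∀ v : ℝ → ℂ, Literature.NumberTheory.LFunctions.IsWeilResolventVector a lam v → Differentiable ℂ (Literature.NumberTheory.LFunctions.weilMellin v) ∧ ∀ s : ℂ, Literature.NumberTheory.LFunctions.weilMellin v s = 0 → s.re = 1 / 2

def ResolventVectorExists : Prop :=
  ∀ a : ℝ, 0 < a → ∀ lam : ℝ, lam < Literature.NumberTheory.LFunctions.weilGroundEnergy a → ∃ v : ℝ → ℂ, Literature.NumberTheory.LFunctions.IsWeilResolventVector a lam v ∧ (∀ t, (v t).im = 0 ∧ v (-t) = v t) ∧ 0 < (Literature.NumberTheory.LFunctions.weilMellin v (1 / 2)).re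

/-- R1 `ResolventVectorExists` is already a tree theorem. -/
theorem resolventVectorExists_holds : ResolventVectorExists := fun a ha lam hlam =>
  Literature.NumberTheory.LFunctions.exists_isWeilResolventVector_real_even_pos ha hlam

/-- R1 equals the corrected-crux text of Lines/birth.lean with the inline parenthesised predicate (Iff.rfl). -/
example : ResolventConvergence ↔
      ∃ (a : ℕ → ℝ) (lam : ℕ → ℝ) (v : ℕ → ℝ → ℂ) (c : ℕ → ℂ) (F : ℂ → ℂ), Tendsto a atTop atTop ∧ (∀ k, 0 < a k ∧ lam k < Literature.NumberTheory.LFunctions.weilGroundEnergy (a k) ∧ c k ≠ 0 ∧ (MemLp (v k) 2 ∧ ∃ g : ℕ → ℝ → ℂ, (∀ n, Literature.NumberTheory.LFunctions.IsWeilTest (g n) ∧ tsupport (g n) ⊆ Icc (-(a k)) (a k)) ∧ (∃ m : ℝ, (∀ h : ℝ → ℂ, Literature.NumberTheory.LFunctions.IsWeilTest h → tsupport h ⊆ Icc (-(a k)) (a k) → m ≤ (Literature.NumberTheory.LFunctions.weilQuadratic h).re - lam k * (∫ t, ‖h t‖ ^ 2) - 2 * (Literature.NumberTheory.LFunctions.weilMellin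 h (1 / 2)).re) ∧ Tendsto (fun n => (Literature.NumberTheory.LFunctions.weilQuadratic (g n)).re - lam k * (∫ t, ‖g n t‖ ^ 2) - 2 * (Literature.NumberTheory.LFunctions.weilMellin (g n) (1 / 2)).re) atTop (𝓝 m)) ∧ Tendsto (fun n => ∫ t, ‖g n t - v k t‖ ^ 2) atTop (𝓝 0))) ∧ TendstoLocallyUniformlyOn (fun k s => c k * Literature.NumberTheory.LFunctions.weilMellin (v k) s) F atTop {s : ℂ | 1 / 2 < s.re ∧ s.re < 1} ∧ (∃ s : ℂ, (1 / 2 < s.re ∧ s.re < 1) ∧ F s ≠ 0) ∧ (∀ s : ℂ, 1 / 2 < s.re → s.re < 1 → Literature.NumberTheory.LFunctions.riemannXi s = 0 → F s = 0) :=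
  Iff.rfl

/-- The route's deciding theorem, proof script copied VERBATIM from Theses/ShiftedResolvent.lean, over the R1 texts. -/
theorem closes (h₂ : ResolventConvergence) (h₃ : ResolventRealZeros) : _root_.Summit.RiemannHypothesis := by
  classical
  obtain ⟨a, lam, v, c, F, -, hk, hlim, ⟨s₀, hs₀U, hFs₀⟩, hvan⟩ := h₂
  -- the approximants and their zeros
  have hF : ∀ k, Differentiable ℂ
      (fun s => c k * _root_.Literature.NumberTheory.LFunctions.weilMellin (v k) s) ∧
      ∀ s, c k * _root_.Literature.NumberTheory.LFunctions.weilMellin (v k) s = 0 → s.re = 1 / 2 := by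
    intro k
    obtain ⟨hak, hlamk, hck, hres⟩ := hk k
    obtain ⟨hdiff, hzero⟩ := h₃ (a k) hak (lam k) hlamk (v k) hres
    refine ⟨(differentiable_const (c k)).mul hdiff, fun s hs => hzero s ?_⟩
    rcases mul_eq_zero.1 hs with h | h
    · exact absurd h hck
    · exact h
  -- the right half of the open critical strip
  set U : Set ℂ := {s : ℂ | 1 / 2 < s.re ∧ s.re < 1} with hUdef
  have hUo : IsOpen U :=
    (isOpen_lt continuous_const Complex.continuous_re).inter (isOpen_lt Complex.continuous_re continuous_const)
  have hUc : Convex ℝ U := (convex_halfSpace_re_gt (1 / 2)).inter (convex_halfSpace_re_lt 1)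
  have hFd : ∀ᶠ k in Filter.atTop, DifferentiableOn ℂ
      (fun s => c k * _root_.Literature.NumberTheory.LFunctions.weilMellin (v k) s) U :=
    Filter.Eventually.of_forall fun k => (hF k).1.differentiableOn
  have hFne : ∃ᶠ k in Filter.atTop, ∀ z ∈ U,
      c k * _root_.Literature.NumberTheory.LFunctions.weilMellin (v k) z ≠ 0 :=
    Filter.Frequently.of_forall fun k z hz hz0 => by
      have := (hF k).2 z hz0
      linarith [hz.1]
  rcases Complex.hurwitz_eqOn_zero_or_forall_ne_zero hUo hUc.isPreconnected hFd hlim hFne with hzero | hne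
  · -- `F ≡ 0` on `U` contradicts the non-vanishing clause
    exact absurd (hzero hs₀U) hFs₀
  · -- `F` is zero-free on `U`, and vanishes at the zeros of `ξ` there: so `ξ` has none
    show _root_.RiemannHypothesis
    intro s hzeta htriv hone
    have hxi := _root_.Literature.NumberTheory.LFunctions.riemannXi_eq_zero_of_nontrivial hzeta htriv hone
    obtain ⟨-, h0, h1⟩ := (_root_.Literature.NumberTheory.LFunctions.riemannXi_eq_zero_iff_holds s).1 hxi
    by_contra hne'
    rcases lt_or_gt_of_ne hne' with hlt | hgt
    · have h1s : (1 - s) ∈ U := by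
        refine ⟨?_, ?_⟩
        · simp only [Complex.sub_re, Complex.one_re]; linarith
        · simp only [Complex.sub_re, Complex.one_re]; linarith
      have hx1 : _root_.Literature.NumberTheory.LFunctions.riemannXi (1 - s) = 0 :=
        (_root_.Literature.NumberTheory.LFunctions.riemannXi_one_sub s).trans hxi
      exact hne (1 - s) h1s (hvan (1 - s) h1s.1 h1s.2 hx1)
    · exact hne s ⟨hgt, h1⟩ (hvan s hgt h1 hxi)

end RestateR1
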